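import Mathlib.Topology.Compactification.OnePoint.Basic
import Literature.Topology.FourManifolds.IntersectionLattice
import Literature.Topology.FourManifolds.Cobordism
import HarnessLib

/-!
# The closed model `W ∪ cone(∂W)` of a compact manifold with boundary, oriented boundaries, and the signature (trunk T-4MAN)

Notions needed to state §7 of Kervaire–Milnor, *Groups of homotopy spheres I*, Ann. of Math. 77
(1963) (Lemma 7.4, Thm. 7.5, Cor. 7.6: the signature `σ(M)` of an s-parallelizable `4m`-manifold
`M` bounded by a homotopy sphere, and "`Σ = bM`" as **oriented** manifolds), layer 2 of the
decomposition of the named fact `Literature.Topology.FourManifolds.exists_commGroup_homotopySphereClass_isCyclic_seven`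
(`HCobordism.lean`; plan in `HomotopySpheresBP.lean`).

## Informal content

* **The closed model.** For a compact smooth `(n+1)`-manifold with boundary `W` (model
  `𝓡∂ (n + 1)`), `Literature.ManifoldInterior n W` is the interior `W ∖ ∂W` as a space and
  `Literature.ClosedModel n W := OnePoint (ManifoldInterior n W)` is its one-point compactification, i.e.
  the quotient `W / ∂W = W ∪ cone(∂W)` (`Literature.boundaryCollapse n W : C(W, ClosedModel n W)` is the
  quotient map: the identity on the interior, `∂W ↦ ∞`). Kervaire–Milnor 1963, footnote to §7,
  pp. 528–529: for `M` bounded by a homology sphere "attach a cone over the boundary, thus obtaining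
  a closed homology manifold with the same signature". When `∂W` is homeomorphic to `𝕊ⁿ` (e.g. a
  homotopy sphere, `n ≥ 5`), `ClosedModel n W` is a closed topological `(n+1)`-manifold
  (`W ∪_{𝕊ⁿ} 𝔻ⁿ⁺¹`); in general it is a compact Hausdorff space, which is all the definitions need.
* **Oriented boundary, homologically.** Mathlib has no orientation of smooth manifolds with
  boundary and no induced boundary orientation; as in `Literature.Topology.FourManifolds.IsOrientedBordant`
  (`BordismFour.lean`, outline D6) the relation "`(M, μ) = ∂(W, μ̂)` as oriented manifolds" is
  expressed through G04's homological orientations and the long exact sequence of the pair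
  `(W, ∂W)`: `Literature.IsOrientedBoundary n f hf μ μ̂` asks for a relative class
  `w ∈ Hₙ₊₁(W, ∂W; ℤ)` with `∂ w = f_* [M]_μ` in `Hₙ(∂W; ℤ)` **and** `q_* w = j_* [Ŵ]_μ̂` in
  `Hₙ₊₁(Ŵ, ∞; ℤ)`, where `f : M → ∂W ⊂ W` is the identification of the boundary, `q : W → Ŵ` the
  collapse and `μ̂` a homological orientation of the closed model `Ŵ`. Classically: `W` is
  oriented, `[W, ∂W]` is its relative fundamental class, `∂[W, ∂W] = [∂W]` for the induced
  boundary orientation (Hatcher, *Algebraic Topology* (2002), §3.3, p. 253 and Thm. 3.43;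
  Bredon, *Topology and Geometry* (1993), VI.9), and `q_* [W, ∂W] = [Ŵ]` since
  `q : (W, ∂W) → (Ŵ, ∞)` is a relative homeomorphism (`Hₙ₊₁(W, ∂W) ≅ Hₙ₊₁(W/∂W, pt)`,
  Hatcher Prop. 2.22). Kervaire–Milnor 1963, §2: "`-M`", "`bW`"; §7: "`Σ₁ = bM₁`".
* **Signature in any dimension `n = k + k`.** `Literature.HomologicalOrientation.signatureInDim h μ` is
  the signature of G04's intersection form `Literature.intersectionForm h μ` on `Hᵏ(X; ℤ)/T`
  (Milnor–Husemoller, *Symmetric Bilinear Forms* (1973), §II.2, §V.1); for `n = 4` it is the tree's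
  `μ.signature` (`signatureInDim_two_add_two`). Kervaire–Milnor's `σ(W)` for `W` of dimension
  `4m` bounded by a homology sphere is `signatureInDim h μ̂` for `μ̂` an orientation of the closed
  model (footnote pp. 528–529: "the signature of the quadratic form `X ↦ X·X` on `H₂ₘ(M)`", equal
  to that of `M ∪ cone(bM)`).

## Design

Everything is stated for a bare `W` with `[ChartedSpace (EuclideanHalfSpace (n + 1)) W]` (plus the
instances each construction needs), not for `Literature.Topology.FourManifolds.NullCobordism` / `Literature.Topology.FourManifolds.Cobordism`, so that it
applies to both; all homology is G04's (`Literature/AlgebraicTopology/SingularHomology`), at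
`R = M = ℤ`, in the universe of `W`. No smooth-versus-homological comparison of orientations is
made here (that bridge, needed to start from the smooth orientation of a homotopy sphere, is a
separate notion).

## Mathlib

`OnePoint` (topology, `CompactSpace`, `T2Space` under local compactness),
`ModelWithCorners.interior/boundary`, `ModelWithCorners.isOpen_interior`; no manifold structure on
interiors or one-point compactifications, no signature of manifolds (searched `OnePoint`,
`signature`, `interior` in `Mathlib/Geometry/Manifold`).
-/

open scoped Manifold ContDiff Topology OnePoint
open Set Function CategoryTheory

noncomputable section

universe u

namespace Literature.Topology.FourManifolds

/-- Local notation: `𝔼 n` is the model Euclidean space `EuclideanSpace ℝ (Fin n)`. -/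
local notation "𝔼 " n:arg => EuclideanSpace ℝ (Fin n)

/-! ### The interior and the closed model `W / ∂W` -/

section ClosedModel

variable (n : ℕ) (W : Type u) [TopologicalSpace W] [ChartedSpace (EuclideanHalfSpace (n + 1)) W]

/-- The **interior** `W ∖ ∂W` of an `(n+1)`-manifold with boundary, as a topological space: the
subtype of Mathlib's `(𝓡∂ (n + 1)).interior W` (points sent by their preferred chart to the
interior of the half-space). Kervaire–Milnor 1963, §1 ("`bM` denotes the boundary of `M`");
Hatcher 2002, §3.3, p. 252 (manifolds with boundary, `M ∖ ∂M`). [folklore] -/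
def ManifoldInterior : Type u :=
  ↥((𝓡∂ (n + 1)).interior W)

/-- The interior carries the subspace topology. [folklore] -/
instance : TopologicalSpace (ManifoldInterior n W) :=
  inferInstanceAs (TopologicalSpace ↥((𝓡∂ (n + 1)).interior W))

/-- The interior of a Hausdorff manifold with boundary is Hausdorff (subspace). [folklore] -/
instance [T2Space W] : T2Space (ManifoldInterior n W) :=
  inferInstanceAs (T2Space ↥((𝓡∂ (n + 1)).interior W))

/-- The interior of a compact Hausdorff `C¹` manifold with boundary is locally compact: it is an
open subset (`ModelWithCorners.isOpen_interior`). [folklore] -/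
instance [T2Space W] [CompactSpace W] [IsManifold (𝓡∂ (n + 1)) 1 W] :
    LocallyCompactSpace (ManifoldInterior n W) :=
  ((𝓡∂ (n + 1)).isOpen_interior (M := W) one_ne_zero).locallyCompactSpace

/-- The **closed model** `Ŵ = W ∪ cone(∂W) = W / ∂W` of a manifold with boundary `W`, realised as
the one-point compactification of the interior `W ∖ ∂W` (the cone point / the image of `∂W` is
`∞`). Kervaire–Milnor 1963, footnote pp. 528–529 ("attach a cone over the boundary, thus
obtaining a closed homology manifold"); Hatcher 2002, Prop. 2.22 (`W/∂W`). For `W`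
compact Hausdorff and `∂W ≃ₜ 𝕊ⁿ` this is the closed topological manifold `W ∪_{𝕊ⁿ} 𝔻ⁿ⁺¹`. [cite: KervaireMilnorAnnals1963, §7, footnote pp. 528–529] -/
def ClosedModel : Type u :=
  OnePoint (ManifoldInterior n W)

/-- The closed model carries the topology of the one-point compactification. [folklore] -/
instance : TopologicalSpace (ClosedModel n W) :=
  inferInstanceAs (TopologicalSpace (OnePoint (ManifoldInterior n W)))

/-- The closed model is compact (one-point compactification). [folklore] -/
instance : CompactSpace (ClosedModel n W) :=
  inferInstanceAs (CompactSpace (OnePoint (ManifoldInterior n W)))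

/-- The closed model of a compact Hausdorff `C¹` manifold with boundary is Hausdorff (the interior
is locally compact Hausdorff). [folklore] -/
instance [T2Space W] [CompactSpace W] [IsManifold (𝓡∂ (n + 1)) 1 W] : T2Space (ClosedModel n W) :=
  inferInstanceAs (T2Space (OnePoint (ManifoldInterior n W)))

variable {n W} in
/-- The cone point `∞ ∈ Ŵ`, image of the whole boundary `∂W`. [folklore] -/
abbrev ClosedModel.infty : ClosedModel n W := (OnePoint.infty : OnePoint (ManifoldInterior n W))

variable {n W} in
/-- The open embedding of the interior into the closed model. [folklore] -/
abbrev ClosedModel.ofInterior (x : ManifoldInterior n W) : ClosedModel n W :=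
  ((x : ManifoldInterior n W) : OnePoint (ManifoldInterior n W))

open Classical in
/-- The **collapse map** `q : W → Ŵ = W / ∂W` as a bare function: the identity on the interior,
the boundary goes to the cone point `∞`. [folklore] -/
def boundaryCollapseFun (x : W) : ClosedModel n W :=
  if h : x ∈ (𝓡∂ (n + 1)).interior W then ClosedModel.ofInterior ⟨x, h⟩ else ClosedModel.infty

variable {n W} in
/-- The collapse function is the identity on interior points. [folklore] -/
theorem boundaryCollapseFun_of_mem {x : W} (h : x ∈ (𝓡∂ (n + 1)).interior W) :
    boundaryCollapseFun n W x = ClosedModel.ofInterior ⟨x, h⟩ := by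
  simp [boundaryCollapseFun, h]

variable {n W} in
/-- The collapse function sends non-interior (i.e. boundary) points to `∞`. [folklore] -/
theorem boundaryCollapseFun_of_not_mem {x : W} (h : x ∉ (𝓡∂ (n + 1)).interior W) :
    boundaryCollapseFun n W x = ClosedModel.infty := by
  simp [boundaryCollapseFun, h]

variable {n W} in
/-- Preimages under the collapse map: for `s ⊆ Ŵ` not containing `∞`, `q ⁻¹ s` is the image in `W`
of the trace of `s` on the interior. [folklore] -/
theorem preimage_boundaryCollapseFun_of_not_mem {s : Set (ClosedModel n W)}
    (hs : ClosedModel.infty ∉ s) :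
    boundaryCollapseFun n W ⁻¹' s =
      Subtype.val '' ((ClosedModel.ofInterior (n := n) (W := W)) ⁻¹' s) := by
  ext x
  simp only [mem_preimage, mem_image, Subtype.exists, exists_and_right, exists_eq_right]
  by_cases hx : x ∈ (𝓡∂ (n + 1)).interior W
  · rw [boundaryCollapseFun_of_mem hx]
    exact ⟨fun h => ⟨hx, h⟩, fun ⟨_, h⟩ => h⟩
  · rw [boundaryCollapseFun_of_not_mem hx]
    exact ⟨fun h => (hs h).elim, fun ⟨h, _⟩ => (hx h).elim⟩

variable {n W} in
/-- Preimages under the collapse map: for `s ⊆ Ŵ` containing `∞`, the complement of `q ⁻¹ s` is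
the image in `W` of the complement of the trace of `s` on the interior. [folklore] -/
theorem compl_preimage_boundaryCollapseFun_of_mem {s : Set (ClosedModel n W)}
    (hs : ClosedModel.infty ∈ s) :
    (boundaryCollapseFun n W ⁻¹' s)ᶜ =
      Subtype.val '' ((ClosedModel.ofInterior (n := n) (W := W)) ⁻¹' s)ᶜ := by
  ext x
  simp only [mem_compl_iff, mem_preimage, mem_image, Subtype.exists, exists_and_right,
    exists_eq_right]
  by_cases hx : x ∈ (𝓡∂ (n + 1)).interior W
  · rw [boundaryCollapseFun_of_mem hx]
    exact ⟨fun h => ⟨hx, h⟩, fun ⟨_, h⟩ => h⟩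
  · rw [boundaryCollapseFun_of_not_mem hx]
    exact ⟨fun h => (h hs).elim, fun ⟨h, _⟩ => (hx h).elim⟩

/-- **Continuity of the collapse** `W → W / ∂W` for `W` compact Hausdorff (and `C¹`, so that the
interior is open): open sets of the one-point compactification avoiding `∞` pull back to open
subsets of the open interior; those containing `∞` have compact, hence closed, complement. [folklore] -/
theorem continuous_boundaryCollapseFun [T2Space W] [CompactSpace W] [IsManifold (𝓡∂ (n + 1)) 1 W] :
    Continuous (boundaryCollapseFun n W) := by
  have hopen : IsOpen ((𝓡∂ (n + 1)).interior W) := (𝓡∂ (n + 1)).isOpen_interior one_ne_zero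
  rw [continuous_def]
  intro s hs
  by_cases hinf : ClosedModel.infty ∈ s
  · -- the complement of the preimage is the continuous image of a compact set
    obtain ⟨hK, -⟩ := (OnePoint.isOpen_iff_of_mem' hinf).1 hs
    rw [← isClosed_compl_iff, compl_preimage_boundaryCollapseFun_of_mem hinf]
    exact (hK.image continuous_subtype_val).isClosed
  · rw [preimage_boundaryCollapseFun_of_not_mem hinf]
    exact hopen.isOpenMap_subtype_val _ ((OnePoint.isOpen_iff_of_notMem hinf).1 hs)

/-- The **collapse map** `q : W → Ŵ = W ∪ cone(∂W)` (identity on the interior, `∂W ↦ ∞`) as a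
continuous map, for `W` a compact Hausdorff `C¹` manifold with boundary (Kervaire–Milnor 1963,
footnote pp. 528–529; Hatcher 2002, Prop. 2.22: `q : (W, ∂W) → (W/∂W, ∂W/∂W)`). [cite: KervaireMilnorAnnals1963, §7, footnote pp. 528–529] -/
def boundaryCollapse [T2Space W] [CompactSpace W] [IsManifold (𝓡∂ (n + 1)) 1 W] :
    C(W, ClosedModel n W) :=
  ⟨boundaryCollapseFun n W, continuous_boundaryCollapseFun n W⟩

variable {n W} in
/-- The continuous collapse map is the collapse function. [folklore] -/
@[simp] theorem boundaryCollapse_apply [T2Space W] [CompactSpace W] [IsManifold (𝓡∂ (n + 1)) 1 W]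
    (x : W) : boundaryCollapse n W x = boundaryCollapseFun n W x := rfl

variable {n W} in
/-- The collapse is the identity on the interior. [folklore] -/
theorem boundaryCollapse_of_mem_interior [T2Space W] [CompactSpace W] [IsManifold (𝓡∂ (n + 1)) 1 W]
    {x : W} (h : x ∈ (𝓡∂ (n + 1)).interior W) :
    boundaryCollapse n W x = ClosedModel.ofInterior ⟨x, h⟩ :=
  boundaryCollapseFun_of_mem h

variable {n W} in
/-- The collapse sends the boundary to the cone point. [folklore] -/
theorem boundaryCollapse_of_mem_boundary [T2Space W] [CompactSpace W] [IsManifold (𝓡∂ (n + 1)) 1 W]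
    {x : W} (h : x ∈ (𝓡∂ (n + 1)).boundary W) :
    boundaryCollapse n W x = ClosedModel.infty :=
  boundaryCollapseFun_of_not_mem (by
    rw [← ModelWithCorners.compl_interior] at h
    exact h)

/-- The collapse maps the pair `(W, ∂W)` to the pair `(Ŵ, {∞})`. [folklore] -/
theorem mapsTo_boundaryCollapse [T2Space W] [CompactSpace W] [IsManifold (𝓡∂ (n + 1)) 1 W] :
    MapsTo (boundaryCollapse n W) ((𝓡∂ (n + 1)).boundary W) {ClosedModel.infty} :=
  fun _ hx => boundaryCollapse_of_mem_boundary hx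

end ClosedModel

/-! ### The signature of a closed oriented manifold of dimension `k + k` -/

section HomologicalOrientation
open Literature.AlgebraicTopology.SingularHomology (HomologicalOrientation)
open Literature.AlgebraicTopology.SingularHomology.HomologicalOrientation

variable {X : Type u} [TopologicalSpace X] {k n : ℕ}

/-- The **signature** `σ(X, μ) ∈ ℤ` of a `ℤ`-oriented space of formal dimension `n = k + k`: the
signature (`b⁺ - b⁻`, `LinearMap.BilinForm.signature` of `LatticeForms`) of G04's intersection
form `Literature.intersectionForm h μ` on `Hᵏ(X; ℤ)/T` (Milnor–Husemoller 1973, §II.2 and §V.1;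
Hirzebruch's signature of a closed oriented `4m`-manifold, `k = 2m`). Meaningful for `X` a closed
topological `n`-manifold (otherwise `[X]` may be the junk value `0` and the signature `0`); for
`k` odd the form is alternating and the value is `0`. The tree's four-dimensional `μ.signature`
(`IntersectionLattice.lean`) is the case `h = two_add_two_eq_four` (`signatureInDim_two_add_two`).
[cite: MilnorHusemoller1973, §II.2 and §V.1] -/
def _root_.Literature.AlgebraicTopology.SingularHomology.HomologicalOrientation.signatureInDim (h : k + k = n) (μ : HomologicalOrientation ℤ X n) : ℤ :=
  (Literature.AlgebraicTopology.SingularHomology.intersectionForm h μ).signature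

/-- Unfolding lemma: the signature in dimension `k + k` is the signature of G04's intersection
form (Milnor–Husemoller 1973, §II.2). [folklore] -/
theorem _root_.Literature.AlgebraicTopology.SingularHomology.HomologicalOrientation.signatureInDim_def (h : k + k = n) (μ : HomologicalOrientation ℤ X n) :
    μ.signatureInDim h = (Literature.AlgebraicTopology.SingularHomology.intersectionForm h μ).signature := rfl

/-- In dimension `4 = 2 + 2` the general signature is the tree's `μ.signature`. [folklore] -/
@[simp] theorem _root_.Literature.AlgebraicTopology.SingularHomology.HomologicalOrientation.signatureInDim_two_add_two (μ : HomologicalOrientation ℤ X 4) :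
    μ.signatureInDim two_add_two_eq_four = μ.signature := rfl

end HomologicalOrientation

/-! ### Oriented boundaries via the pair sequence and the closed model -/

section OrientedBoundary

variable (n : ℕ) {W : Type u} [TopologicalSpace W] [ChartedSpace (EuclideanHalfSpace (n + 1)) W]
  {M : Type u} [TopologicalSpace M]

/-- Corestriction of a boundary identification `f : M → W` (with values in `∂W`) to the subspace
`∂W`, as needed to push `[M]` into `Hₙ(∂W; ℤ)`. [folklore] -/
def boundaryCorestrict (f : C(M, W)) (hf : ∀ x, f x ∈ (𝓡∂ (n + 1)).boundary W) :
    C(M, ↥((𝓡∂ (n + 1)).boundary W)) :=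
  ⟨fun x => ⟨f x, hf x⟩, f.continuous.subtype_mk hf⟩

/-- The corestriction to `∂W` has the same values in `W`. [folklore] -/
@[simp] theorem boundaryCorestrict_apply_coe (f : C(M, W)) (hf : ∀ x, f x ∈ (𝓡∂ (n + 1)).boundary W)
    (x : M) : (boundaryCorestrict n f hf x : W) = f x := rfl

variable [T2Space W] [CompactSpace W] [IsManifold (𝓡∂ (n + 1)) 1 W]

/-- **`(M, μ)` is the oriented boundary of `(W, μ̂)` along `f`**, homologically. Data: a compact
Hausdorff `C¹` `(n+1)`-manifold with boundary `W`, a map `f : M → W` with values in `∂W` (the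
identification `M ≅ ∂W`, e.g. `Literature.Topology.FourManifolds.NullCobordism.incl`), a homological `ℤ`-orientation `μ` of
`M` and a homological `ℤ`-orientation `μ̂` of the closed model `Ŵ = W ∪ cone(∂W)`
(`Literature.ClosedModel n W`), which plays the role of the orientation of `W`. The condition: there is a
relative class `w ∈ Hₙ₊₁(W, ∂W; ℤ)` — the relative fundamental class `[W, ∂W]` — with
(i) `∂ w = f_* [M]_μ` in `Hₙ(∂W; ℤ)` (connecting homomorphism of the pair; "the orientation of
`W` induces `μ` on the boundary": `∂[W, ∂W] = [∂W]`, Hatcher 2002, §3.3, p. 253 and Thm. 3.43;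
Bredon 1993, VI.9; this is the clause of `Literature.Topology.FourManifolds.IsOrientedBordant`), and
(ii) `q_* w = j_* [Ŵ]_μ̂` in `Hₙ₊₁(Ŵ, {∞}; ℤ)`, `q : (W, ∂W) → (Ŵ, ∞)` the collapse and `j_*` the
map from absolute homology ("`μ̂` is the orientation of `W`": `q` induces
`Hₙ₊₁(W, ∂W) ≅ Hₙ₊₁(W/∂W, pt)`, Hatcher 2002, Prop. 2.22, carrying `[W, ∂W]` to the image of
`[Ŵ]`). Kervaire–Milnor 1963 write "`Σ = bM`" (§7) and "`-M`" (§2) for these oriented notions; the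
sign conventions (boundary orientation = `∂` of the pair sequence) are Hatcher's. Only
`[TopologicalSpace M]` is assumed on `M` (the closed-manifold instances making `[M]_μ` meaningful
are supplied by users). [cite: KervaireMilnorAnnals1963, §2 ("-M") and §7 ("Σ = bM"), with footnote pp. 528–529] [cite: Hatcher2002, §3.3 p. 253, Thm. 3.43, Prop. 2.22] -/
def IsOrientedBoundary (f : C(M, W)) (hf : ∀ x, f x ∈ (𝓡∂ (n + 1)).boundary W)
    (μ : Literature.AlgebraicTopology.SingularHomology.HomologicalOrientation ℤ M n) (μ' : Literature.AlgebraicTopology.SingularHomology.HomologicalOrientation ℤ (ClosedModel n W) (n + 1)) :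
    Prop :=
  ∃ w : ↥(Literature.AlgebraicTopology.SingularHomology.relativeSingularHomology ℤ ℤ W ((𝓡∂ (n + 1)).boundary W) (n + 1)),
    Literature.AlgebraicTopology.SingularHomology.relativeSingularHomology.δ ℤ ℤ W ((𝓡∂ (n + 1)).boundary W) n w =
        Literature.AlgebraicTopology.SingularHomology.singularHomology.map ℤ ℤ (boundaryCorestrict n f hf) n μ.fundamentalClass ∧
      Literature.AlgebraicTopology.SingularHomology.relativeSingularHomology.map ℤ ℤ (boundaryCollapse n W) (mapsTo_boundaryCollapse n W)
          (n + 1) w =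
        Literature.AlgebraicTopology.SingularHomology.relativeSingularHomology.ofAbsolute ℤ ℤ (ClosedModel n W) {ClosedModel.infty} (n + 1)
          μ'.fundamentalClass

variable {n}

/-- Unfolding lemma for `IsOrientedBoundary`. [folklore] -/
theorem isOrientedBoundary_iff (f : C(M, W)) (hf : ∀ x, f x ∈ (𝓡∂ (n + 1)).boundary W)
    (μ : Literature.AlgebraicTopology.SingularHomology.HomologicalOrientation ℤ M n) (μ' : Literature.AlgebraicTopology.SingularHomology.HomologicalOrientation ℤ (ClosedModel n W) (n + 1)) :
    IsOrientedBoundary n f hf μ μ' ↔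
      ∃ w : ↥(Literature.AlgebraicTopology.SingularHomology.relativeSingularHomology ℤ ℤ W ((𝓡∂ (n + 1)).boundary W) (n + 1)),
        Literature.AlgebraicTopology.SingularHomology.relativeSingularHomology.δ ℤ ℤ W ((𝓡∂ (n + 1)).boundary W) n w =
            Literature.AlgebraicTopology.SingularHomology.singularHomology.map ℤ ℤ (boundaryCorestrict n f hf) n μ.fundamentalClass ∧
          Literature.AlgebraicTopology.SingularHomology.relativeSingularHomology.map ℤ ℤ (boundaryCollapse n W) (mapsTo_boundaryCollapse n W)
              (n + 1) w =
            Literature.AlgebraicTopology.SingularHomology.relativeSingularHomology.ofAbsolute ℤ ℤ (ClosedModel n W) {ClosedModel.infty} (n + 1)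
              μ'.fundamentalClass :=
  Iff.rfl

/-- **`b(-W) = -bW`** (Kervaire–Milnor 1963, §2): reversing both orientations preserves the
oriented-boundary relation — negate the relative class `w` — provided the fundamental classes
change sign with the orientation, which is G04's named fact `fundamentalClass_neg` (Hatcher 2002,
§3.3, p. 236), here taken as the hypotheses `hM`, `hW` in the form needed. [cite: KervaireMilnorAnnals1963, §2] -/
theorem IsOrientedBoundary.neg {f : C(M, W)} {hf : ∀ x, f x ∈ (𝓡∂ (n + 1)).boundary W}
    {μ : Literature.AlgebraicTopology.SingularHomology.HomologicalOrientation ℤ M n} {μ' : Literature.AlgebraicTopology.SingularHomology.HomologicalOrientation ℤ (ClosedModel n W) (n + 1)}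
    (h : IsOrientedBoundary n f hf μ μ')
    (hM : (-μ).fundamentalClass = -μ.fundamentalClass)
    (hW : (-μ').fundamentalClass = -μ'.fundamentalClass) :
    IsOrientedBoundary n f hf (-μ) (-μ') := by
  obtain ⟨w, hw₁, hw₂⟩ := h
  refine ⟨-w, ?_, ?_⟩
  · rw [map_neg, hw₁, hM, map_neg]
  · rw [map_neg, hw₂, hW, map_neg]

end OrientedBoundary

end Literature.Topology.FourManifolds
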